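import Mathlib.LinearAlgebra.Matrix.Charpoly.Coeff
import Literature.NumberTheory.GaloisRepresentations.ModNCyclotomicCharacter
import Literature.RepresentationTheory.FiniteGroups.InvariantLineOfFixedVectors
import HarnessLib

/-!
# Odd irreducible two-dimensional representations are absolutely irreducible; the cyclotomic
character of a complex conjugation (proofs)

Topic `Literature/NumberTheory/GaloisRepresentations`.  A *proofs* file (theorems only), used by
`Literature.NumberTheory.EllipticCurves.NewformGaloisRepDeligneProofs` to pass from the
irreducibility printed in Diamond–Shurman, *A First Course in Modular Forms*, Thm. 9.6.5
("an irreducible 2-dimensional Galois representation `ρ_{f,λ} : G_ℚ → GL₂(K_{f,λ})`") and the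
oddness printed on the same page ("`det ρ_{f,λ}(conj) = -1`") to the absolute irreducibility
asserted by the tree's named fact `Literature.NumberTheory.EllipticCurves.ModularForms.exists_padicGaloisRep_of_isNewform1`
(Darmon–Diamond–Taylor, *Fermat's Last Theorem*, Thm. 3.1 (c); Ribet 1977, Thm. 2.3).

* `FramedRep.isAbsolutelyIrreducible_of_isIrreducible_of_det_eq_neg_one` — over a field `A`
  with `2 ≠ 0`, a framed representation `ρ : G →ₜ* GL₂(A)` which is irreducible over `A` and
  contains an involution of determinant `-1` (`c² = 1`, `det ρ(c) = -1`) is absolutely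
  irreducible (`FramedRep.IsAbsolutelyIrreducible`: irreducible after every base change
  `A →+* B` to a field).  This is the remark of Darmon–Diamond–Taylor 1995, p. 87 ("if `ℓ` is
  odd, one checks using (b) [oddness] that `ρ̄` is irreducible if and only if it is absolutely
  irreducible"), valid verbatim in characteristic `≠ 2`.  Proof: `ρ(c)` is a non-scalar
  involution, so its `±1`-eigenspaces are lines defined over `A`; an invariant line after base
  change to `B` is `ρ(c)`-stable, hence is one of these two eigenlines base-changed, and then the
  corresponding `A`-line is already invariant — contradicting irreducibility over `A`.
* `FramedGaloisRep.IsOdd.isAbsolutelyIrreducible` — for a field `K` with a real embedding, an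
  odd (`FramedGaloisRep.IsOdd`) irreducible `ρ : Γ_K → GL₂(A)`, `2 ≠ 0` in `A`, is absolutely
  irreducible (complex conjugations exist and are involutions:
  `exists_isComplexConjugation`, `IsComplexConjugation.sq_eq_one`).
* `Matrix.det_eq_of_charpoly_eq` — a `2 × 2` matrix with characteristic polynomial
  `X² - a X + b` has determinant `b` (any commutative ring; the tree's
  `ModularForms.DeligneSerre1974.det_eq_of_charpoly_eq` is the case `ℂ`).
* `continuous_comp_modNCyclotomicCharacter` — any function of `χ_N(σ)` (the mod `N` cyclotomic
  character `modNCyclotomicCharacter K N`, locally constant by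
  `modNCyclotomicCharacter_eventually_eq_one`) is continuous on `Γ_K`; used for `λ`-adic avatars
  `σ ↦ ι(ε(χ_N σ))` of a Dirichlet character `ε`, where no topology relates `ι` to `ℂ`.
* `GaloisRep.cyclotomicCharacter_of_isComplexConjugation` — **`χ_ℓ(c) = -1`**: a complex
  conjugation `c ∈ Γ_K` acts on the `ℓ`-power roots of unity of `K̄` by inversion (they lie on
  the unit circle under any embedding `K̄ → ℂ`), so the `ℓ`-adic cyclotomic character
  (`GaloisRep.cyclotomicCharacter`, Mathlib `cyclotomicCharacter`) takes the value `-1` at `c`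
  (Serre, *Abelian `ℓ`-adic representations*, I-1.2; Diamond–Shurman §9.3, "`χ_ℓ(conj) = -1`").

## References

* H. Darmon, F. Diamond, R. Taylor, *Fermat's Last Theorem*, Current Developments in Math. 1995,
  Thm. 3.1 (b), (c) and p. 87. [DarmonDiamondTaylor1995]
* F. Diamond, J. Shurman, *A First Course in Modular Forms*, GTM 228 (2005), §9.3 and
  Thm. 9.6.5 with the discussion following it (PDF p. 435). [DiamondShurman2005]
* J.-P. Serre, *Abelian ℓ-adic representations and elliptic curves* (1968), Ch. I §1.2.
  [SerreAbelianLadic1968]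
-/

noncomputable section

open scoped NumberField Matrix
open Field Module

namespace Literature.NumberTheory.GaloisRepresentations

universe u v

/-! ### Linear algebra of a non-scalar involution of the plane -/

section Plane

variable {F : Type*} [Field F]

/-- An eigenvector equation `M x = s x` with `det M ≠ s²` on the plane `F²` cuts out at most a
line: if `v ≠ 0` is one solution then every solution is a multiple of `v` (the solution space is
a proper — `M ≠ s` as `det M ≠ s²` — non-zero subspace of a plane). [folklore] -/
theorem Matrix.mem_span_of_mulVec_eq_smul {M : Matrix (Fin 2) (Fin 2) F} {s : F}
    (hdet : M.det ≠ s * s) {v : Fin 2 → F} (hv : v ≠ 0) (hMv : M *ᵥ v = s • v)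
    {x : Fin 2 → F} (hMx : M *ᵥ x = s • x) : x ∈ Submodule.span F {v} := by
  classical
  -- the solution space as the kernel of `x ↦ M x - s x`
  let T : (Fin 2 → F) →ₗ[F] (Fin 2 → F) := Matrix.toLin' M - s • LinearMap.id
  have hmem : ∀ y : Fin 2 → F, y ∈ LinearMap.ker T ↔ M *ᵥ y = s • y := fun y ↦ by
    simp only [T, LinearMap.mem_ker, LinearMap.sub_apply, Matrix.toLin'_apply,
      LinearMap.smul_apply, LinearMap.id_apply, sub_eq_zero]
  have h2 : finrank F (Fin 2 → F) = 2 := Module.finrank_fin_fun F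
  have hbot : LinearMap.ker T ≠ ⊥ := by
    intro h
    have : v ∈ LinearMap.ker T := (hmem v).mpr hMv
    rw [h, Submodule.mem_bot] at this
    exact hv this
  have htop : LinearMap.ker T ≠ ⊤ := by
    intro h
    apply hdet
    -- every vector is a solution, so `M = s • 1`
    have hcol : ∀ j, M *ᵥ Pi.single j 1 = s • Pi.single j 1 := fun j ↦
      (hmem _).mp (h ▸ Submodule.mem_top)
    have hM : M = s • (1 : Matrix (Fin 2) (Fin 2) F) := by
      ext i j
      have := congr_fun (hcol j) i
      rw [Matrix.mulVec_single_one, Matrix.col_apply] at this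
      rw [this]
      by_cases hij : i = j
      · subst hij; simp
      · simp [hij]
    rw [hM, Matrix.det_smul, Matrix.det_one, mul_one, Fintype.card_fin, pow_two]
  have hline : finrank F (LinearMap.ker T) = 1 :=
    Literature.RepresentationTheory.FiniteGroups.Representation.finrank_eq_one_of_ne_bot_of_ne_top
      h2 hbot htop
  have hspan : Submodule.span F {v} = LinearMap.ker T :=
    Submodule.eq_of_le_of_finrank_eq
      ((Submodule.span_singleton_le_iff_mem v _).mpr ((hmem v).mpr hMv))
      (by rw [finrank_span_singleton hv, hline])
  rw [hspan]
  exact (hmem x).mpr hMx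

/-- For an involution `M` of the plane (`M² = 1`) with `det M = -1` over a field with `2 ≠ 0`
and a sign `s = ±1`, the matrix `M + s` is non-zero (otherwise `M = -s` would have determinant
`s² = 1`), and any of its non-zero columns `v` satisfies `M v = s v`
(`M (M + s) = 1 + s M = s (M + s)`): both eigenlines of `M` are defined over the ground field.
[folklore] -/
theorem Matrix.exists_mulVec_eq_smul_of_involutive {M : Matrix (Fin 2) (Fin 2) F}
    (hMM : M * M = 1) (hdet : M.det = -1) (h2 : (2 : F) ≠ 0) {s : F} (hs : s * s = 1) :
    ∃ v : Fin 2 → F, v ≠ 0 ∧ M *ᵥ v = s • v := by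
  classical
  set Q : Matrix (Fin 2) (Fin 2) F := M + s • (1 : Matrix (Fin 2) (Fin 2) F) with hQ
  have hQne : Q ≠ 0 := by
    intro h
    have hM : M = -(s • (1 : Matrix (Fin 2) (Fin 2) F)) := eq_neg_of_add_eq_zero_left h
    rw [hM, Matrix.det_neg, Matrix.det_smul, Matrix.det_one, Fintype.card_fin] at hdet
    have : (1 : F) = -1 := by
      calc (1 : F) = (-1) ^ 2 * (s ^ 2 * 1) := by rw [pow_two s, hs]; norm_num
        _ = -1 := hdet
    apply h2
    calc (2 : F) = 1 - (-1) := by norm_num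
      _ = 0 := by rw [← this, sub_self]
  -- some column of `Q` is non-zero
  obtain ⟨j, hj⟩ : ∃ j, Q *ᵥ Pi.single j 1 ≠ 0 := by
    by_contra hall
    push Not at hall
    apply hQne
    ext i j
    have := congr_fun (hall j) i
    rwa [Matrix.mulVec_single_one, Matrix.col_apply] at this
  refine ⟨Q *ᵥ Pi.single j 1, hj, ?_⟩
  have hMQ : M * Q = s • Q := by
    rw [hQ, mul_add, hMM, Matrix.mul_smul, mul_one, smul_add, smul_smul, hs, one_smul, add_comm]
  rw [Matrix.mulVec_mulVec, hMQ, Matrix.smul_mulVec]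

/-- Descent of a line along a field extension: if `f : A →+* B` is a ring homomorphism of
fields, `v ≠ 0` an `A`-vector and `y` an `A`-vector whose image is a `B`-multiple of the image
of `v`, then `y` is already an `A`-multiple of `v`. [folklore] -/
theorem mem_span_of_comp_mem_span {A B : Type*} [Field A] [Field B] (f : A →+* B) {n : ℕ}
    {v : Fin n → A} (hv : v ≠ 0) {y : Fin n → A}
    (hy : (f ∘ y) ∈ Submodule.span B {f ∘ v}) : y ∈ Submodule.span A {v} := by
  obtain ⟨b, hb⟩ := Submodule.mem_span_singleton.mp hy
  obtain ⟨i, hi⟩ : ∃ i, v i ≠ 0 := by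
    by_contra h
    push Not at h
    exact hv (funext h)
  refine Submodule.mem_span_singleton.mpr ⟨y i / v i, funext fun j ↦ ?_⟩
  have hbi : b * f (v i) = f (y i) := congr_fun hb i
  have hbj : b * f (v j) = f (y j) := congr_fun hb j
  have hfb : f (y i / v i) = b := by
    rw [map_div₀, ← hbi, mul_div_assoc, div_self ((map_ne_zero f).mpr hi), mul_one]
  apply f.injective
  rw [Pi.smul_apply, smul_eq_mul, map_mul, hfb, hbj]

/-- The determinant of a `2 × 2` matrix with characteristic polynomial `X² - a X + b` is `b`
(Mathlib `Matrix.det_eq_sign_charpoly_coeff`; any commutative ring). [folklore] -/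
theorem Matrix.det_eq_of_charpoly_eq {R : Type*} [CommRing R] {M : Matrix (Fin 2) (Fin 2) R}
    {a b : R} (h : M.charpoly = Polynomial.X ^ 2 - Polynomial.C a * Polynomial.X + Polynomial.C b) :
    M.det = b := by
  rw [Matrix.det_eq_sign_charpoly_coeff, h]
  simp

end Plane

/-! ### Functions of the mod `N` cyclotomic character are continuous -/

section ModN

variable (K : Type*) [Field K] (N : ℕ) [NeZero N] [NeZero (N : K)]

/-- **Functions of `χ_N` are locally constant, hence continuous.**  For any map
`g : (ℤ/Nℤ)ˣ → X` to a topological space, `σ ↦ g (χ_N σ)` is continuous on `Γ_K`: near `σ₀`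
write `σ = σ₀ τ` with `τ` close to `1`, where `χ_N τ = 1`
(`modNCyclotomicCharacter_eventually_eq_one`), so `χ_N σ = χ_N σ₀`. [folklore] -/
theorem continuous_comp_modNCyclotomicCharacter {X : Type*} [TopologicalSpace X]
    (g : (ZMod N)ˣ → X) : Continuous fun σ ↦ g (modNCyclotomicCharacter K N σ) := by
  refine continuous_iff_continuousAt.mpr fun σ₀ ↦ ?_
  have ht : Filter.Tendsto (fun σ : absoluteGaloisGroup K ↦ σ₀⁻¹ * σ) (nhds σ₀) (nhds 1) := by
    have hc : Continuous fun σ : absoluteGaloisGroup K ↦ σ₀⁻¹ * σ :=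
      continuous_const.mul continuous_id
    have h := hc.tendsto σ₀
    rwa [inv_mul_cancel] at h
  have hev : ∀ᶠ σ in nhds σ₀,
      g (modNCyclotomicCharacter K N σ₀) = g (modNCyclotomicCharacter K N σ) := by
    filter_upwards [ht.eventually (modNCyclotomicCharacter_eventually_eq_one K N)] with σ hσ
    have h1 : modNCyclotomicCharacter K N σ = modNCyclotomicCharacter K N σ₀ := by
      have h2 := congrArg (modNCyclotomicCharacter K N σ₀ * ·) hσ
      simp only [← map_mul, mul_inv_cancel_left, mul_one] at h2
      exact h2
    rw [h1]
  exact (continuousAt_const (y := g (modNCyclotomicCharacter K N σ₀))).congr hev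

end ModN

/-! ### Odd irreducible plane representations are absolutely irreducible -/

section AbsIrr

variable {G : Type u} [Group G] [TopologicalSpace G] {A : Type v} [Field A] [TopologicalSpace A]

/-- **An irreducible two-dimensional representation containing an involution of determinant
`-1` is absolutely irreducible** (characteristic `≠ 2`).  Let `ρ : G →ₜ* GL₂(A)` be irreducible
over the field `A` (`FramedRep.IsIrreducible`), `2 ≠ 0` in `A`, and `c ∈ G` with `c² = 1` and
`det ρ(c) = -1`.  Then `ρ` stays irreducible after any base change `f : A →+* B` to a field
(`FramedRep.IsAbsolutelyIrreducible`).  Indeed `M = ρ(c)` is a non-scalar involution whose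
`±1`-eigenlines are defined over `A` (`Matrix.exists_mulVec_eq_smul_of_involutive`); a
`G`-stable `B`-line `L ⊂ B²` is `M`-stable, so spanned by an eigenvector of `M`, hence equal to
a base-changed eigenline `B · f(v)` (`Matrix.mem_span_of_mulVec_eq_smul`); then
`f(ρ(g) v) ∈ B · f(v)` for all `g`, so `ρ(g) v ∈ A · v` (`mem_span_of_comp_mem_span`) and `A · v`
is a `G`-stable line of `A²`, contradicting irreducibility.  (Darmon–Diamond–Taylor 1995, p. 87:
"if `ℓ` is odd, one checks using (b) that `ρ̄` is irreducible if and only if it is absolutely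
irreducible".) [cite: DarmonDiamondTaylor1995, Thm. 3.1 (b)–(c) and p. 87] -/
theorem FramedRep.isAbsolutelyIrreducible_of_isIrreducible_of_det_eq_neg_one
    (ρ : FramedRep G A 2) (hirr : ρ.IsIrreducible) (h2 : (2 : A) ≠ 0) {c : G} (hc : c * c = 1)
    (hdet : Matrix.GeneralLinearGroup.det (ρ c) = -1) : ρ.IsAbsolutelyIrreducible := by
  intro B _ f
  classical
  set M : Matrix (Fin 2) (Fin 2) A := ((ρ c : GL (Fin 2) A) : Matrix (Fin 2) (Fin 2) A) with hM
  have hMM : M * M = 1 := by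
    rw [hM, ← Units.val_mul, ← map_mul, hc, map_one, Units.val_one]
  have hdetM : M.det = -1 := by
    have h := congrArg (fun u : Aˣ ↦ (u : A)) hdet
    simpa only [Matrix.GeneralLinearGroup.val_det_apply, Units.val_neg, Units.val_one] using h
  have h2B : (2 : B) ≠ 0 := by
    have : f 2 ≠ 0 := (map_ne_zero f).mpr h2
    rwa [map_ofNat] at this
  -- base-changed matrices
  set ρB := ρ.baseChangeRepresentation f with hρB
  have hρBapply : ∀ (g : G) (x : Fin 2 → B),
      ρB g x = (((ρ g : GL (Fin 2) A) : Matrix (Fin 2) (Fin 2) A).map f) *ᵥ x := fun g x ↦ rfl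
  have hmapv : ∀ (g : G) (w : Fin 2 → A),
      (((ρ g : GL (Fin 2) A) : Matrix (Fin 2) (Fin 2) A).map f) *ᵥ (f ∘ w) =
        f ∘ ((((ρ g : GL (Fin 2) A) : Matrix (Fin 2) (Fin 2) A)) *ᵥ w) := fun g w ↦
    funext fun i ↦ (RingHom.map_mulVec f _ w i).symm
  set MB : Matrix (Fin 2) (Fin 2) B := M.map f with hMB
  have hMBMB : MB * MB = 1 := by
    rw [hMB, ← Matrix.map_mul, hMM, Matrix.map_one _ (map_zero f) (map_one f)]
  have hdetMB : MB.det ≠ (1 : B) := by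
    rw [hMB, ← RingHom.mapMatrix_apply, ← RingHom.map_det, hdetM, map_neg, map_one]
    intro h
    apply h2B
    calc (2 : B) = 1 - (-1) := by norm_num
      _ = 0 := by rw [h, sub_self]
  -- the subrepresentations of `ρB` form a simple order
  have h2F : finrank B (Fin 2 → B) = 2 := Module.finrank_fin_fun B
  have hbt : (⊥ : Subrepresentation ρB) ≠ ⊤ := by
    intro h
    have h' : (⊥ : Submodule B (Fin 2 → B)) = ⊤ := congrArg Subrepresentation.toSubmodule h
    exact bot_ne_top h'
  refine { toNontrivial := ⟨⟨⊥, ⊤, hbt⟩⟩, eq_bot_or_eq_top := fun W ↦ ?_ }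
  by_contra hW
  push Not at hW
  -- `L = W` is a `G`-stable line of `B²`
  set L : Submodule B (Fin 2 → B) := W.toSubmodule with hL
  have hLbot : L ≠ ⊥ := fun h ↦ hW.1 (Subrepresentation.toSubmodule_injective h)
  have hLtop : L ≠ ⊤ := fun h ↦ hW.2 (Subrepresentation.toSubmodule_injective h)
  have hL1 : finrank B L = 1 :=
    Literature.RepresentationTheory.FiniteGroups.Representation.finrank_eq_one_of_ne_bot_of_ne_top
      h2F hLbot hLtop
  have hLstab : ∀ (g : G) {x : Fin 2 → B}, x ∈ L →
      (((ρ g : GL (Fin 2) A) : Matrix (Fin 2) (Fin 2) A).map f) *ᵥ x ∈ L := fun g x hx ↦ by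
    rw [← hρBapply]
    exact W.apply_mem_toSubmodule g hx
  -- a non-zero vector `w` spanning `L`, and a non-zero eigenvector `x ∈ L` of `MB` with sign `s`
  haveI : FiniteDimensional B (Fin 2 → B) := inferInstance
  obtain ⟨w, hwL, hw0⟩ : ∃ w ∈ L, w ≠ 0 := Submodule.exists_mem_ne_zero_of_ne_bot hLbot
  obtain ⟨s, hs, x, hxL, hx0, hMBx⟩ : ∃ s : A, s * s = 1 ∧ ∃ x ∈ L, x ≠ 0 ∧ MB *ᵥ x = f s • x := by
    by_cases hw : MB *ᵥ w + w = 0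
    · refine ⟨-1, by ring, w, hwL, hw0, ?_⟩
      rw [map_neg, map_one, neg_one_smul]
      exact eq_neg_of_add_eq_zero_left hw
    · refine ⟨1, by ring, MB *ᵥ w + w, L.add_mem (hLstab c hwL) hwL, hw, ?_⟩
      rw [map_one, one_smul, Matrix.mulVec_add, Matrix.mulVec_mulVec, hMBMB, Matrix.one_mulVec,
        add_comm]
  -- the `s`-eigenline of `M` is defined over `A`
  obtain ⟨v, hv0, hMv⟩ := Matrix.exists_mulVec_eq_smul_of_involutive hMM hdetM h2 hs
  have hfv0 : (f ∘ v) ≠ 0 := by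
    intro h
    apply hv0
    funext i
    exact f.injective ((congr_fun h i).trans (map_zero f).symm)
  have hMBfv : MB *ᵥ (f ∘ v) = f s • (f ∘ v) := by
    rw [hMB, hM, hmapv c v, hMv]
    funext i
    simp only [Function.comp_apply, Pi.smul_apply, smul_eq_mul, map_mul]
  have hdetMB' : MB.det ≠ f s * f s := by rwa [← map_mul, hs, map_one]
  -- hence `x ∈ B · f(v)`, so `f(v) ∈ L` and `L = B · f(v)`
  have hxspan : x ∈ Submodule.span B {f ∘ v} :=
    Matrix.mem_span_of_mulVec_eq_smul hdetMB' hfv0 hMBfv hMBx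
  obtain ⟨b, rfl⟩ := Submodule.mem_span_singleton.mp hxspan
  have hb0 : b ≠ 0 := by
    rintro rfl
    exact hx0 (zero_smul _ _)
  have hfvL : (f ∘ v) ∈ L := by
    have := L.smul_mem b⁻¹ hxL
    rwa [smul_smul, inv_mul_cancel₀ hb0, one_smul] at this
  have hLeq : Submodule.span B {f ∘ v} = L :=
    Literature.RepresentationTheory.FiniteGroups.Representation.eq_of_finrank_eq_one_of_mem
      (finrank_span_singleton hfv0) hL1 hfv0 (Submodule.mem_span_singleton_self _) hfvL
  -- so the `A`-line `A · v` is `G`-stable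
  have hvstab : ∀ g : G,
      (((ρ g : GL (Fin 2) A) : Matrix (Fin 2) (Fin 2) A)) *ᵥ v ∈ Submodule.span A {v} := by
    intro g
    refine mem_span_of_comp_mem_span f hv0 ?_
    rw [← hmapv g v, hLeq]
    exact hLstab g hfvL
  let S : Subrepresentation ρ.toRepresentation :=
    { toSubmodule := Submodule.span A {v}
      apply_mem_toSubmodule := fun g y hy ↦ by
        obtain ⟨a, rfl⟩ := Submodule.mem_span_singleton.mp hy
        rw [map_smul, FramedRep.toRepresentation_apply_apply]
        exact Submodule.smul_mem _ a (hvstab g) }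
  have h2A : finrank A (Fin 2 → A) = 2 := Module.finrank_fin_fun A
  have hS := Literature.RepresentationTheory.FiniteGroups.Representation.ne_bot_and_ne_top_of_finrank_eq_one
    h2A (finrank_span_singleton hv0)
  rcases hirr.eq_bot_or_eq_top S with h | h
  · exact hS.1 (congrArg Subrepresentation.toSubmodule h)
  · exact hS.2 (congrArg Subrepresentation.toSubmodule h)

/-- **Odd irreducible two-dimensional Galois representations are absolutely irreducible**
(characteristic `≠ 2`): for a field `K` admitting a real embedding `φ : K →+* ℝ`, a framed
Galois representation `ρ : Γ_K → GL₂(A)` over a field `A` with `2 ≠ 0` which is odd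
(`FramedGaloisRep.IsOdd`: `det ρ(c) = -1` for every complex conjugation `c`) and irreducible over
`A` is absolutely irreducible — complex conjugations for `φ` exist
(`exists_isComplexConjugation`) and are involutions (`IsComplexConjugation.sq_eq_one`).
(Darmon–Diamond–Taylor 1995, Thm. 3.1 (b)–(c) and p. 87.)
[cite: DarmonDiamondTaylor1995, Thm. 3.1 (b)–(c) and p. 87] -/
theorem FramedGaloisRep.IsOdd.isAbsolutelyIrreducible {K : Type u} [Field K] (φ : K →+* ℝ)
    {ρ : FramedGaloisRep K A 2} (hodd : ρ.IsOdd) (hirr : FramedRep.IsIrreducible ρ)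
    (h2 : (2 : A) ≠ 0) : FramedRep.IsAbsolutelyIrreducible ρ := by
  obtain ⟨c, hc⟩ := exists_isComplexConjugation φ
  have hcc : c * c = 1 := by rw [← pow_two]; exact hc.sq_eq_one
  exact FramedRep.isAbsolutelyIrreducible_of_isIrreducible_of_det_eq_neg_one ρ hirr h2 hcc
    (hodd φ c hc)

end AbsIrr

/-! ### The cyclotomic character of a complex conjugation -/

section Cyclotomic

variable {K : Type u} [Field K] (ℓ : ℕ) [Fact ℓ.Prime]

/-- **`χ_ℓ(c) = -1` for a complex conjugation `c`.**  Let `c ∈ Γ_K` be a complex conjugation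
for a real embedding `φ : K →+* ℝ` (`IsComplexConjugation φ c`: `ι (c • x) = conj (ι x)` for an
embedding `ι : K̄ → ℂ` over `φ`).  Every `ℓⁿ`-th root of unity `t ∈ K̄` has `|ι t| = 1`, so
`ι (c • t) = conj (ι t) = (ι t)⁻¹` and `c • t = t⁻¹ = t ^ (ℓⁿ - 1)`; by the uniqueness clause of
Mathlib's `modularCyclotomicCharacter`, `χ_ℓ(c) ≡ -1 (mod ℓⁿ)` for all `n`, i.e. `χ_ℓ(c) = -1`
in `ℤ_ℓ` (`PadicInt.ext_of_toZModPow`).  (Serre, *Abelian `ℓ`-adic representations*, I-1.2;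
Diamond–Shurman §9.3: "`χ_ℓ(conj) = -1`".)
[cite: SerreAbelianLadic1968, Ch. I §1.2 (Example: the cyclotomic character)] -/
theorem GaloisRep.cyclotomicCharacter_of_isComplexConjugation {φ : K →+* ℝ}
    {c : absoluteGaloisGroup K} (hc : IsComplexConjugation φ c) :
    ((GaloisRep.cyclotomicCharacter K ℓ c : ℤ_[ℓ]ˣ) : ℤ_[ℓ]) = -1 := by
  classical
  haveI : CharZero K := charZero_of_realEmbedding φ
  haveI : NeZero (ℓ : K) := ⟨Nat.cast_ne_zero.mpr (Fact.out : ℓ.Prime).ne_zero⟩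
  obtain ⟨ι, -, hι⟩ := isComplexConjugation_iff.mp hc
  refine PadicInt.ext_of_toZModPow.mp fun n ↦ ?_
  rw [map_neg, map_one, GaloisRep.cyclotomicCharacter_apply, cyclotomicCharacter.toZModPow]
  set g := MulSemiringAction.toRingAut (absoluteGaloisGroup K) (AlgebraicClosure K) c with hg
  symm
  refine modularCyclotomicCharacter.unique (AlgebraicClosure K)
    (HasEnoughRootsOfUnity.natCard_rootsOfUnity (AlgebraicClosure K) (ℓ ^ n)) g
    (c := (-1 : ZMod (ℓ ^ n))) fun t ht ↦ ?_
  -- `t` is an `ℓⁿ`-th root of unity: `c • t = t⁻¹ = t ^ (ℓⁿ - 1)`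
  obtain ⟨m, hm⟩ : ∃ m, ℓ ^ n = m + 1 := Nat.exists_eq_succ_of_ne_zero (NeZero.ne (ℓ ^ n))
  have htN : ((t : (AlgebraicClosure K)ˣ) : AlgebraicClosure K) ^ ℓ ^ n = 1 := by
    have := congrArg Units.val ((mem_rootsOfUnity _ t).mp ht)
    simpa using this
  have hnorm : ‖ι t‖ = 1 :=
    Complex.norm_eq_one_of_pow_eq_one (by rw [← map_pow, htN, map_one]) (NeZero.ne (ℓ ^ n))
  have hct : c • (t : AlgebraicClosure K) = (t : AlgebraicClosure K) ^ m := by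
    apply ι.injective
    rw [hι, ← Complex.inv_eq_conj hnorm, map_pow]
    rw [hm, pow_succ] at htN
    rw [← map_pow]
    exact inv_eq_of_mul_eq_one_left (by rw [← map_mul, htN, map_one])
  have hval : ((-1 : ZMod (ℓ ^ n))).val = m := by
    have h1 : ((-1 : ZMod (ℓ ^ n))) = (m : ZMod (ℓ ^ n)) := by
      have h0 : ((m : ℕ) : ZMod (ℓ ^ n)) + 1 = 0 := by
        have h : ((m + 1 : ℕ) : ZMod (ℓ ^ n)) = 0 := by
          rw [← hm]
          exact ZMod.natCast_self _
        push_cast at h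
        exact h
      exact (eq_neg_of_add_eq_zero_left h0).symm
    rw [h1, ZMod.val_natCast, Nat.mod_eq_of_lt (by omega)]
  rw [hval, hg, MulSemiringAction.toRingAut_apply]
  exact hct

end Cyclotomic

end Literature.NumberTheory.GaloisRepresentations
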